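import Summits.QuantumFields.GaugeBoot.CubicTorusRP
import HarnessLib

/-!
# The staggered central twist `β ↦ -β` of the Wilson measure of a periodic lattice
# (gauge-boot, L3 structural supplement, part 1 of 3)

HONEST FRAMING (cell `pub-gaugeboot`, page 1 of every file): the venture produces certified bounds
on lattice expectations at stated coupling, gauge group, dimension and torus size; NOT a mass gap,
NOT a continuum limit, NOT a string tension; NOT Yang–Mills-summit-bearing (barriers
`FixedCouplingUltralocality`, `PerturbativeInvisibility`). This module bounds no expectation; no
certificate of the cell sits at `β < 0`.

`TiltedSiteRPAnyBeta.lean` removed the idle sign hypothesis `0 ≤ β` from the SITE family of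
reflection positivities (no plaquette is cut by a site hyperplane). The LINK family
(`IsSiteFrame.linkRP_integral_conj_mul_nonneg`, `cubicTorus_linkRP`) genuinely uses `0 ≤ β`: the
plaquettes crossing the hyperplane `x_k = ½` contribute the kernel `exp(β Re tr ρ(V₁ A V₂⁻¹ B⁻¹))`,
of positive type only for `β ≥ 0`. This module records the classical exception: whenever the gauge
group has a CENTRAL element `z` with `z² = 1` represented by `ρ z = -1` — `SU(2)`, `SU(2n)`, `U(N)`
in the fundamental representation; not `SU(3)` — and the periodic lattice carries mod-2 coordinate
parities (the cubic torus of EVEN side), the Kogut–Susskind STAGGERED CENTRAL TWIST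
`U_l ↦ z^{c(l)} U_l`, `c(x, m) = ∑_{m' ≺ m} x_{m'} (mod 2)`, flips every plaquette
(`U_p ↦ z U_p`, `Re tr ρ(U_p) ↦ -Re tr ρ(U_p)`), preserves the product Haar measure, and therefore
maps the Wilson measure at coupling `β` onto the Wilson measure at coupling `-β`
(Li–Meurice, Phys. Rev. D 71 (2005) 016008: "for `SU(2N)` on even lattices
`Z(-β) = e^{2β𝒩_p} Z(β)`", quoted in Meurice arXiv:0910.5785 p. 3). Ordering the axes with the
reflected axis `r` LAST makes the twist commute with the site reflection `x_r ↦ -x_r` AND with the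
link reflection `x_r ↦ 1 - x_r` and preserve their half-space observable classes; hence every
reflection-positivity statement along `r` at `β` transfers to `-β`.

* `centralTwist s U = (l ↦ s l · U l)`; `IsStaggering e z s` (central involutive values whose
  product around every plaquette is `z`); `holonomy_centralTwist` (`U_p ↦ z U_p`),
  `plaqObs_centralTwist` (`ρ z = -1` ⇒ `Re tr ρ U_p ↦ -Re tr ρ U_p`), `wilsonAction_centralTwist`
  (`S ↦ 2N#P - S`), `measurePreserving_centralTwist` (product Haar measure);
* ★ `IsStaggering.integral_comp_centralTwist_gibbs`: `∫ F(T_s U) dμ_β(U) = ∫ F dμ_{-β}` for EVERY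
  `F` (any finite periodic lattice `(A, e)` with a staggering, compact `G`, any `ρ` with `ρ z = -1`,
  every real `β`); `map_centralTwist_gibbs` (`μ_β ∘ T_s⁻¹ = μ_{-β}`); `normaliser_neg_eq`
  (`Z(-β) = e^{2βN#P} Z(β)`); `integral_plaqObs_gibbs_neg` (the plaquette expectation is ODD in
  `β`); `integral_conj_mul_gibbs_neg_eq(₂)` (reflection-positivity integrals at `-β` are those of
  the twisted observables at `β`, for any reflection commuting with `T_s`).

The sequel `StaggeredParityTwist.lean` CONSTRUCTS a staggering from mod-2 coordinate parities with
a chosen axis `r` last (commuting with the site and link reflections of a site frame along `r`) and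
derives link reflection positivity at every real `β`; `CubicTorusLinkRPAnyBeta.lean` instantiates
everything on the even cubic torus `(ℤ/2Q)^d` for `U(N)`, `SU(2)`, `SU(2n)`.

What is NOT claimed: nothing for `SU(3)` / `SU(2n+1)` at `β < 0` (no central element with
`ρ z = -1`; link RP at negative coupling is neither proved nor refuted here); nothing for the
DIAGONAL family at `β < 0` — a swap-symmetric twist cannot flip the plaquette at a site of the
mirror `x_i = x_j` (its four links are exchanged in pairs), so `IsTiltedFrame.integral_conj_mul_nonneg`
keeps `0 ≤ β`; nothing about infinite volume. Structural; NOT a bound on any expectation.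

References: L. Li, Y. Meurice, Phys. Rev. D 71 (2005) 016008 (arXiv:hep-lat/0410029) §II;
Y. Meurice, PoS LAT2009 (arXiv:0910.5785) p. 3; J. Kogut, L. Susskind, Phys. Rev. D 11 (1975) 395
(staggered phases); K. Osterwalder, E. Seiler, Ann. Phys. 110 (1978) 440 §2; E. Seiler, LNP 159
(1982) Ch. 2; V. Kazakov, Z. Zheng, arXiv:2203.11360 §3.1.
-/

noncomputable section

open MeasureTheory Complex
open scoped ComplexOrder ComplexConjugate
open Literature.MathematicalPhysics.QuantumFieldTheory (haarProbability Site GaugeConfig wilsonMeasure)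
open Literature.MathematicalPhysics.QuantumLattice (fundamentalRep unitaryFundamentalRep
  continuous_fundamentalRep continuous_unitaryFundamentalRep)
open Literature.RepresentationTheory.CompactGroups

namespace Summit.QuantumFields.GaugeBoot

namespace TiltedRP

variable {A : Type*} [AddCommGroup A] {d N : ℕ} {G : Type*} [Group G]

/-! ## The central twist of configurations -/

/-- **The central twist** of configurations by link weights `s`: `(T_s U)(l) = s(l) · U(l)`. -/
def centralTwist (s : Link A d → G) (U : Config A d G) : Config A d G := fun l => s l * U l

omit [AddCommGroup A] in
/-- `centralTwist` evaluated. -/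
@[simp] theorem centralTwist_apply (s : Link A d → G) (U : Config A d G) (l : Link A d) :
    centralTwist s U l = s l * U l := rfl

/-- **A staggering** of the periodic lattice `(A, e)` with value `z`: link weights `s(l)` that are
central, square to one, and whose product around EVERY plaquette is `z`
(the Kogut–Susskind sign rule `η₁η₂η₃η₄ = -1`, written multiplicatively in `G`).
[shape] A hypothesis structure (a `Prop`), asserting nothing. [folklore] -/
structure IsStaggering (e : Fin d → A) (z : G) (s : Link A d → G) : Prop where
  /-- every weight is central -/
  comm : ∀ l g, s l * g = g * s l
  /-- every weight squares to one -/
  mul_self : ∀ l, s l * s l = 1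
  /-- the product of the four weights of every plaquette is `z` -/
  plaq : ∀ x (k l : Fin d), k ≠ l → s (x, k) * s (x + e k, l) * s (x + e l, k) * s (x, l) = z

namespace IsStaggering

variable {e : Fin d → A} {z : G} {s : Link A d → G} (hs : IsStaggering e z s)
include hs

/-- The weights are their own inverses. -/
theorem inv_eq (l : Link A d) : (s l)⁻¹ = s l := inv_eq_of_mul_eq_one_right (hs.mul_self l)

/-- `g (s(l) h) = s(l) (g h)`. -/
theorem left_comm (l : Link A d) (g h : G) : g * (s l * h) = s l * (g * h) := by
  rw [← mul_assoc, ← hs.comm l g, mul_assoc]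

/-- **The twist is an involution.** -/
@[simp] theorem centralTwist_centralTwist (U : Config A d G) :
    centralTwist s (centralTwist s U) = U := by
  funext l
  simp [← mul_assoc, hs.mul_self]

/-- The twist is involutive. -/
theorem centralTwist_involutive : Function.Involutive (centralTwist (d := d) s : Config A d G → _) :=
  hs.centralTwist_centralTwist

/-- **Every plaquette holonomy is multiplied by `z`**: `(T_s U)_p = z · U_p`. -/
theorem holonomy_centralTwist (U : Config A d G) (x : A) {k l : Fin d} (hkl : k ≠ l) :
    holonomy e (centralTwist s U) x k l = z * holonomy e U x k l := by
  unfold holonomy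
  simp only [centralTwist_apply, mul_inv_rev, hs.inv_eq]
  rw [← hs.plaq x k l hkl]
  -- move the central weights to the front
  set a := s (x, k); set b := s (x + e k, l); set c := s (x + e l, k); set f := s (x, l)
  calc a * U (x, k) * (b * U (x + e k, l)) * ((U (x + e l, k))⁻¹ * c) * ((U (x, l))⁻¹ * f)
      = a * (U (x, k) * (b * (U (x + e k, l) * ((U (x + e l, k))⁻¹ * (c * ((U (x, l))⁻¹ * f)))))) := by
        simp only [mul_assoc]
    _ = a * (b * (U (x, k) * (U (x + e k, l) * (c * ((U (x + e l, k))⁻¹ * (f * (U (x, l))⁻¹)))))) := by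
        rw [hs.left_comm (x + e k, l), hs.left_comm (x + e l, k), ← hs.comm (x, l)]
    _ = a * (b * (U (x, k) * (c * (U (x + e k, l) * (f * ((U (x + e l, k))⁻¹ * (U (x, l))⁻¹)))))) := by
        rw [hs.left_comm (x + e l, k) (U (x + e k, l)), hs.left_comm (x, l) ((U (x + e l, k))⁻¹)]
    _ = a * (b * (c * (U (x, k) * (f * (U (x + e k, l) * ((U (x + e l, k))⁻¹ * (U (x, l))⁻¹)))))) := by
        rw [hs.left_comm (x + e l, k) (U (x, k)), hs.left_comm (x, l) (U (x + e k, l))]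
    _ = a * (b * (c * (f * (U (x, k) * (U (x + e k, l) * ((U (x + e l, k))⁻¹ * (U (x, l))⁻¹)))))) := by
        rw [hs.left_comm (x, l) (U (x, k))]
    _ = a * b * c * f * (U (x, k) * U (x + e k, l) * (U (x + e l, k))⁻¹ * (U (x, l))⁻¹) := by
        simp only [mul_assoc]

variable (ρ : G →* Matrix (Fin N) (Fin N) ℂ)

/-- **Every plaquette observable changes sign** when `ρ z = -1`:
`Re tr ρ((T_s U)_p) = -Re tr ρ(U_p)`. -/
theorem plaqObs_centralTwist (hρz : ρ z = -1) (p : Plaq A d) (U : Config A d G) :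
    plaqObs ρ e p (centralTwist s U) = -plaqObs ρ e p U := by
  unfold plaqObs
  rw [hs.holonomy_centralTwist U p.1 (ne_of_lt p.2.2), map_mul, hρz, neg_one_mul, Matrix.trace_neg,
    Complex.neg_re]

/-- **The Wilson action under the twist**: `S(T_s U) = 2N#P - S(U)`. -/
theorem wilsonAction_centralTwist [Fintype A] (hρz : ρ z = -1) (U : Config A d G) :
    wilsonAction ρ e (centralTwist s U) = 2 * N * Fintype.card (Plaq A d) - wilsonAction ρ e U := by
  unfold wilsonAction
  simp_rw [hs.plaqObs_centralTwist ρ hρz, sub_neg_eq_add, Finset.sum_add_distrib,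
    Finset.sum_sub_distrib, Finset.sum_const, Finset.card_univ, nsmul_eq_mul]
  ring

/-- **The Boltzmann weight under the twist**: `e^{-β S(T_s U)} = e^{-β·2N#P} · e^{-(-β) S(U)}`. -/
theorem boltzmann_centralTwist [Fintype A] (hρz : ρ z = -1) (β : ℝ) (U : Config A d G) :
    Real.exp (-β * wilsonAction ρ e (centralTwist s U)) =
      Real.exp (-β * (2 * N * Fintype.card (Plaq A d))) * Real.exp (-(-β) * wilsonAction ρ e U) := by
  rw [hs.wilsonAction_centralTwist ρ hρz, ← Real.exp_add]
  congr 1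
  ring

end IsStaggering

/-! ## The twist and the Wilson measure: `μ_β ∘ T⁻¹ = μ_{-β}` -/

section Measure

variable [Fintype A] [TopologicalSpace G] [IsTopologicalGroup G] [CompactSpace G] [MeasurableSpace G]
  [BorelSpace G]

omit [AddCommGroup A] [Fintype A] [CompactSpace G] in
/-- The twist is measurable. -/
theorem measurable_centralTwist (s : Link A d → G) :
    Measurable (centralTwist (d := d) s : Config A d G → Config A d G) :=
  measurable_pi_lambda _ fun l =>
    ((measurable_pi_apply l : Measurable fun U : Config A d G => U l)).const_mul (s l)

omit [AddCommGroup A] in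
/-- **The twist preserves the product Haar measure** (left invariance of the Haar probability
measure in every factor). -/
theorem measurePreserving_centralTwist (s : Link A d → G) :
    MeasurePreserving (centralTwist (d := d) s) (productHaar A d G) (productHaar A d G) := by
  haveI : IsProbabilityMeasure (haarProbability G) :=
    CompactGroup.isProbabilityMeasure_haarMeasure_top
  haveI : (haarProbability G).IsMulLeftInvariant := by
    unfold haarProbability; infer_instance
  have key := measurePreserving_pi (fun _ : Link A d => haarProbability G)
    (fun _ : Link A d => haarProbability G) (f := fun l (x : G) => s l * x)
    fun l => measurePreserving_mul_left (haarProbability G) (s l)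
  unfold productHaar
  exact key

variable {e : Fin d → A} {z : G} {s : Link A d → G}

/-- The twist as a measurable equivalence of configurations (an involution). -/
def IsStaggering.centralTwistEquiv (hs : IsStaggering e z s) : Config A d G ≃ᵐ Config A d G where
  toFun := centralTwist s
  invFun := centralTwist s
  left_inv := hs.centralTwist_centralTwist
  right_inv := hs.centralTwist_centralTwist
  measurable_toFun := measurable_centralTwist s
  measurable_invFun := measurable_centralTwist s

omit [Fintype A] [CompactSpace G] in
/-- `centralTwistEquiv` is the twist. -/
@[simp] theorem IsStaggering.coe_centralTwistEquiv (hs : IsStaggering e z s) :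
    ⇑(hs.centralTwistEquiv (G := G)) = centralTwist s := rfl

variable (ρ : G →* Matrix (Fin N) (Fin N) ℂ)

/-- Change of variables under the twist for the product Haar measure:
`∫ F(T_s U) ∏dU = ∫ F ∏dU`. -/
theorem IsStaggering.integral_comp_centralTwist_productHaar (hs : IsStaggering e z s)
    {V : Type*} [NormedAddCommGroup V] [NormedSpace ℝ V] (F : Config A d G → V) :
    ∫ U, F (centralTwist s U) ∂(productHaar A d G) = ∫ U, F U ∂(productHaar A d G) := by
  have h := integral_map_equiv (μ := productHaar A d G) hs.centralTwistEquiv F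
  rw [hs.coe_centralTwistEquiv, (measurePreserving_centralTwist (A := A) (G := G) s).map_eq] at h
  exact h.symm

/-- **`Z(β) = e^{-β·2N#P} Z(-β)`** (the normalisers of the Wilson weights at `±β`). -/
theorem IsStaggering.normaliser_eq_mul_normaliser_neg (hs : IsStaggering e z s) (hρz : ρ z = -1)
    (β : ℝ) :
    ∫ U, Real.exp (-β * wilsonAction ρ e U) ∂(productHaar A d G) =
      Real.exp (-β * (2 * N * Fintype.card (Plaq A d))) *
        ∫ U, Real.exp (-(-β) * wilsonAction ρ e U) ∂(productHaar A d G) := by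
  rw [← hs.integral_comp_centralTwist_productHaar (fun U => Real.exp (-β * wilsonAction ρ e U))]
  simp_rw [hs.boltzmann_centralTwist ρ hρz β]
  exact integral_const_mul _ _

/-- **`Z(-β) = e^{2βN#P} Z(β)`** (Li–Meurice 2005 / Meurice 2009, eq. `Z(-β) = e^{2β𝒩_p} Z(β)`,
for the Wilson action `S = ∑_p (N - Re tr ρ U_p)` and `Z(β) = ∫ e^{-βS} ∏dU`). -/
theorem IsStaggering.normaliser_neg_eq (hs : IsStaggering e z s) (hρz : ρ z = -1) (β : ℝ) :
    ∫ U, Real.exp (-(-β) * wilsonAction ρ e U) ∂(productHaar A d G) =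
      Real.exp (2 * β * N * Fintype.card (Plaq A d)) *
        ∫ U, Real.exp (-β * wilsonAction ρ e U) ∂(productHaar A d G) := by
  rw [hs.normaliser_eq_mul_normaliser_neg ρ hρz β, ← mul_assoc, ← Real.exp_add]
  have : 2 * β * N * Fintype.card (Plaq A d) + -β * (2 * N * Fintype.card (Plaq A d)) = 0 := by ring
  rw [this, Real.exp_zero, one_mul]

/-- ★ **The staggered central twist maps the Wilson measure at `β` onto the Wilson measure at `-β`**:
`∫ F(T_s U) dμ_β(U) = ∫ F dμ_{-β}` for EVERY `F` (any finite periodic lattice with a staggering,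
compact `G`, every `ρ` with `ρ z = -1` — no continuity needed — and every real `β`). -/
theorem IsStaggering.integral_comp_centralTwist_gibbs (hs : IsStaggering e z s)
    (hρz : ρ z = -1) (β : ℝ) {V : Type*} [NormedAddCommGroup V] [NormedSpace ℝ V]
    (F : Config A d G → V) :
    ∫ U, F (centralTwist s U) ∂(gibbs ρ e β) = ∫ U, F U ∂(gibbs ρ e (-β)) := by
  rw [integral_gibbs, integral_gibbs]
  set Z := ∫ U, Real.exp (-β * wilsonAction ρ e U) ∂(productHaar A d G) with hZ
  set Z' := ∫ U, Real.exp (-(-β) * wilsonAction ρ e U) ∂(productHaar A d G) with hZ'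
  set C := Real.exp (-β * (2 * N * Fintype.card (Plaq A d))) with hC
  have hZZ' : Z = C * Z' := hs.normaliser_eq_mul_normaliser_neg ρ hρz β
  have hCpos : 0 < C := Real.exp_pos _
  -- substitute `U = T_s V` in the left-hand side
  rw [← hs.integral_comp_centralTwist_productHaar
    (fun U => (Real.exp (-β * wilsonAction ρ e U) / Z) • F (centralTwist s U))]
  refine integral_congr_ae (ae_of_all _ fun U => ?_)
  simp only [hs.centralTwist_centralTwist, hs.boltzmann_centralTwist ρ hρz β, hZZ']
  rw [mul_div_mul_left _ _ hCpos.ne']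

/-- The same identity read backwards: `∫ F dμ_{-β} = ∫ F(T_s U) dμ_β(U)`; equivalently
`∫ F(T_s U) dμ_{-β}(U) = ∫ F dμ_β`. -/
theorem IsStaggering.integral_comp_centralTwist_gibbs_neg (hs : IsStaggering e z s)
    (hρz : ρ z = -1) (β : ℝ) {V : Type*} [NormedAddCommGroup V] [NormedSpace ℝ V]
    (F : Config A d G → V) :
    ∫ U, F (centralTwist s U) ∂(gibbs ρ e (-β)) = ∫ U, F U ∂(gibbs ρ e β) := by
  have h := hs.integral_comp_centralTwist_gibbs ρ hρz (-β) F
  rwa [neg_neg] at h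

/-- **The plaquette expectation is ODD in `β`**: `∫ Re tr ρ(U_p) dμ_{-β} = -∫ Re tr ρ(U_p) dμ_β`
(Meurice: `P(β) + P(-β) = 2` for `P = 1 - (1/N) Re tr`). -/
theorem IsStaggering.integral_plaqObs_gibbs_neg (hs : IsStaggering e z s) (hρz : ρ z = -1) (β : ℝ)
    (p : Plaq A d) :
    ∫ U, plaqObs ρ e p U ∂(gibbs ρ e (-β)) = -∫ U, plaqObs ρ e p U ∂(gibbs ρ e β) := by
  rw [← hs.integral_comp_centralTwist_gibbs ρ hρz β (plaqObs ρ e p)]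
  simp_rw [hs.plaqObs_centralTwist ρ hρz]
  exact integral_neg _

/-- **RP-type integrals at `-β` are integrals of the twisted observables at `β`**: for every map
`Θ` of configurations commuting with the twist and every `F₁, F₂`,
`∫ conj F₁(ΘU) · F₂(U) dμ_{-β} = ∫ conj (F₁∘T_s)(ΘU) · (F₂∘T_s)(U) dμ_β`. -/
theorem IsStaggering.integral_conj_mul_gibbs_neg_eq₂ (hs : IsStaggering e z s) (hρz : ρ z = -1)
    (β : ℝ) {Θ : Config A d G → Config A d G}
    (hΘ : ∀ U, centralTwist s (Θ U) = Θ (centralTwist s U)) (F₁ F₂ : Config A d G → ℂ) :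
    ∫ U, conj (F₁ (Θ U)) * F₂ U ∂(gibbs ρ e (-β)) =
      ∫ U, conj (F₁ (centralTwist s (Θ U))) * F₂ (centralTwist s U) ∂(gibbs ρ e β) := by
  rw [← hs.integral_comp_centralTwist_gibbs ρ hρz β (fun U => conj (F₁ (Θ U)) * F₂ U)]
  simp_rw [hΘ]

/-- `∫ conj F(ΘU) · F(U) dμ_{-β} = ∫ conj (F∘T_s)(ΘU) · (F∘T_s)(U) dμ_β` (`Θ` commuting with the
twist). -/
theorem IsStaggering.integral_conj_mul_gibbs_neg_eq (hs : IsStaggering e z s) (hρz : ρ z = -1)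
    (β : ℝ) {Θ : Config A d G → Config A d G}
    (hΘ : ∀ U, centralTwist s (Θ U) = Θ (centralTwist s U)) (F : Config A d G → ℂ) :
    ∫ U, conj (F (Θ U)) * F U ∂(gibbs ρ e (-β)) =
      ∫ U, conj (F (centralTwist s (Θ U))) * F (centralTwist s U) ∂(gibbs ρ e β) :=
  hs.integral_conj_mul_gibbs_neg_eq₂ ρ hρz β hΘ F F

variable [SecondCountableTopology G]

/-- **Measure form**: the push-forward of `μ_β` under the twist is `μ_{-β}` (continuous `ρ`). -/
theorem IsStaggering.map_centralTwist_gibbs (hs : IsStaggering e z s) (hρ : Continuous ρ)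
    (hρz : ρ z = -1) (β : ℝ) :
    (gibbs ρ e β).map (centralTwist s) = gibbs (A := A) (G := G) ρ e (-β) := by
  haveI := isProbabilityMeasure_gibbs (A := A) (G := G) ρ hρ e β
  haveI := isProbabilityMeasure_gibbs (A := A) (G := G) ρ hρ e (-β)
  refine Measure.ext fun S hS => ?_
  rw [Measure.map_apply (measurable_centralTwist s) hS]
  have h1 := hs.integral_comp_centralTwist_gibbs ρ hρz β (S.indicator (1 : Config A d G → ℝ))
  rw [integral_indicator_one hS] at h1
  have h2 : ∫ U, S.indicator (1 : Config A d G → ℝ) (centralTwist s U) ∂(gibbs ρ e β) =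
      (gibbs ρ e β).real (centralTwist s ⁻¹' S) := by
    rw [← integral_indicator_one ((measurable_centralTwist s) hS)]
    rfl
  rw [h2, measureReal_def, measureReal_def] at h1
  exact (ENNReal.toReal_eq_toReal_iff' (measure_ne_top _ _) (measure_ne_top _ _)).1 h1

end Measure

end TiltedRP

end Summit.QuantumFields.GaugeBoot
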